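import Literature.NumberTheory.Automorphic.Liu2021.LemD1Item3AtVOfSeparation
import Literature.NumberTheory.Automorphic.Liu2021.LemD1AsPrintedIndexedQuotTransport
import Literature.NumberTheory.GelbartRogawski1991.LocalLineModelTransport
import HarnessLib

/-!
# [Liu2021, Lem. D.1 (3)] on `localIndexedFamilyAtV … (Equiv.prodUnique (Fin N) (Fin 1)) … v`, the «⇐» direction: two members whose
# transported sections are LINE-TRANSPORTS of each other and whose Step-3 characters agree have isomorphic `ω(μ, ε, χ)` — THEOREMS ONLY

Topic `NumberTheory/Automorphic/Liu2021`; namespaces `Literature.RepresentationTheory.MoeglinVignerasWaldspurger1987` (§1, one plumbing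
identity in the currency of `RankOneThetaLiftLinesEquivalent.lean`) and `Literature.NumberTheory.Automorphic.Liu2021.Def411WeilCarriers`
(§2–§3, the indexed family `localIndexedFamilyAtV … v` of `Def411WeilCarriersLocalDataAtV.lean`).  KERNEL ONLY: theorems, no definition, no
named fact, no `sorry`.  Nothing of [Liu2021] or [MoeglinVignerasWaldspurger1987] is asserted.

## What this file is, and why (cell hodgecm-mathlib, fan A, line `a4-liuD3`, stub (:203) `stub_iso_of_params : IsoOfParams`)

The binder `hD3` of the cell's headline is [Liu2021, App. D Lem. D.1 (3)] AS PRINTED («If `n ≥ 3`, then `ω(μ', ε', χ')` is isomorphic to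
`ω(μ, ε, χ)` if and only if `(μ', ε', χ') = (μ, ε, χ)`», l. 5233) read on the INDEXED FAMILY `localIndexedFamilyAtV … v`
(`LemD1_3AsPrintedI`).  Its «⇐» direction (right-hand side ⟹ left-hand side) is the stub `stub_iso_of_params` of the crux skeleton
`a4-liuD3`: equal `(μ_v, ε-class, χ_v)` ⟹ `AreIsomorphicRep (quot j) (quot i)`.  The mathematics is the ISOMETRY TRANSPORT along the class
witness `x` (`a_j⁻¹δ ⊗ 1 = x xᶜ (a_i⁻¹δ ⊗ 1)`): in the δ-model `LocalMp F N T_V v` common to all members (B-p13's `e′_a` line-model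
transport `lineTransportSection`, `LocalLineModelTransport.lean`), the operator `M_x` of a lift of the transport `γ_x`
([MoeglinVignerasWaldspurger1987, Chap. 2 II.1]; tree `lineTransportOp`, `lineTransportOp_equivariant` of
`RankOneThetaLiftLinesEquivalent.lean`) intertwines `ω_{s_i}` with `ω_{q_x s_i q_x⁻¹}`; so AS SOON AS the transported splitting
`q_x s_i q_x⁻¹ = lineTransportSplitting … x … (s_i)` IS member `j`'s section `s_j` (hypothesis `hsec` — supplied by the line-rigidity
identity S6a of the `χ`-splitting together with the locality of the Kudla section in `μ_v`, both OUTSIDE this file), `M_x⁻¹` is an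
`U(V)(F_v)`-equivariant identification of the two carriers, and B-p13's quot-plumbing
`LemD1IndexedFamily.areIsomorphicRep_quot_of_equivariant` (`LemD1AsPrintedIndexedQuotTransport.lean`) gives the printed isomorphism once
`χ_j = χ_i`.

* §1 `lineTransportOp_symm_equivariant` — `M_x⁻¹ ω_{s₂}(g) = ω_{s₁}(g) M_x⁻¹` for `s₂` the transported splitting (the inverse reading of
  `lineTransportOp_equivariant`).
* §1b `lineTransportSection_congr` — equal pair-model sections have equal `e′_a`-transported sections (section proofs irrelevant).
* §2 `exists_lineDelta_witness_of_sameClass_eps` — the `ε`-summand `LemD1.SameClass (eps i) (eps j)` of `LemD1_3AsPrintedI` at the family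
  (representatives `(a_t δ) ⊗ 1`) yields a unit `x` with `a_j⁻¹δ ⊗ 1 = x xᶜ (a_i⁻¹δ ⊗ 1)` — the hypothesis `hx` of `lineTransportSplitting`
  at the transported lines `δ'_t = a_t⁻¹ δ` (`sameClass_epsLine_iff_sameClass_eps_lineDelta`, the classes differ by the norms `a_t²`).
* §3 **`areIsomorphicRep_quot_of_lineTransportSplitting_eq_prodUnique`** — for the indexed family at the reindexing
  `Equiv.prodUnique (Fin N) (Fin 1)` (any rank `N ≥ 3`, ANY finite place `v`, ANY splitting families `𝓢_t`, ANY Step-2 characters):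
  `lineTransportSplitting … x … (s_i) = s_j` and `chi j = chi i` ⟹ `AreIsomorphicRep (quot j) (quot i)`.

HC_CM is proved only modulo the 7 printed citations (`hDel`, `h21`, `hLiu418`, `h411`, `h413`, `hD3`, `hD1''`) until rung 0 closes; this file
discharges none of them and no interface fact (it is the place-free plumbing of one of five stubs of the `hD3` line).

## References
* [Liu2021] Y. Liu, Camb. J. Math. 9 (2021) = arXiv:2102.11518 — App. D §D.1 Steps 1–3 (l. 5213–5224), Lemma D.1 (3) (l. 5233).
* [MoeglinVignerasWaldspurger1987] C. Mœglin, M.-F. Vignéras, J.-L. Waldspurger, LNM 1291, Chap. 2 II.1 (A)–(B), Chap. 3 I.1–I.3, IV.4.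
* [HarrisKudlaSweet1996] M. Harris, S. Kudla, W. Sweet, JAMS 9 (1996), §1 (splittings transported along isometries).
-/

set_option autoImplicit false

noncomputable section

open scoped Matrix Kronecker
open NumberField IsDedekindDomain
open Literature.NumberTheory.Automorphic Literature.NumberTheory.Automorphic.UnitaryGroup
open Literature.RepresentationTheory
open Literature.RepresentationTheory.HeisenbergGroup (MpPsi)
open Literature.NumberTheory.GelbartRogawski1991 Literature.NumberTheory.GelbartRogawski1991.UnitaryDualPair
open Literature.NumberTheory.GelbartRogawski1991.UnitaryDualPair.LocalSplitting

/-! ## §1 The inverse operator `M_x⁻¹` intertwines the transported splitting back to the original one -/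

namespace Literature.RepresentationTheory.MoeglinVignerasWaldspurger1987

section Metaplectic

variable {F : Type} [Field F] [NumberField F] (E : Type) [Field E] [NumberField E] [Algebra F E]
  [Algebra.IsQuadraticExtension F E] (v : HeightOneSpectrum (𝓞 F)) (c : E ≃ₐ[F] E) (N : ℕ)
  {δ₁ δ₂ : E} (hcδ₁ : c δ₁ = -δ₁) (hδ₁ : δ₁ ≠ 0) {d₁ : F} (hd₁ : δ₁ * δ₁ = algebraMap F E d₁)
  (hcδ₂ : c δ₂ = -δ₂) (hδ₂ : δ₂ ≠ 0) {d₂ : F} (hd₂ : δ₂ * δ₂ = algebraMap F E d₂) (x : (LocalRing E v)ˣ)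
  (T : Matrix (Fin N) (Fin N) F) (hT : T.IsSymm) (hTd : IsUnit T.det) {J : Matrix (Fin N) (Fin N) E}
  (hx : algebraMap E (LocalRing E v) δ₂ = (x : LocalRing E v) * conjLocal E c v x * algebraMap E (LocalRing E v) δ₁)

/-- **`M_x⁻¹` is `U(J)(F_v)`-equivariant from `ω_{s₂}` back to `ω_{s₁}`**, `s₂ = lineTransportSplitting … x … s₁` the transported splitting,
`ω_s := (MpPsi.toRep (localSchrodinger F N T v)).comp s`: `M_x⁻¹ (ω_{s₂}(g) Φ) = ω_{s₁}(g) (M_x⁻¹ Φ)` — the inverse reading of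
`lineTransportOp_equivariant`. [cite: MoeglinVignerasWaldspurger1987, Chap. 2 II.1 (A)–(B); Chap. 3 I.1–I.3] -/
theorem lineTransportOp_symm_equivariant (s₁ : localPi E c N J v →* LocalMp F N T v) (g : localPi E c N J v)
    (Φ : SchwartzBruhat (Fin N → v.adicCompletion F)) :
    (lineTransportOp E v c N hcδ₁ hδ₁ hd₁ hcδ₂ hδ₂ hd₂ x T hT hTd hx).symm
        (((MpPsi.toRep (localSchrodinger F N T v)).comp
          (lineTransportSplitting E v c N hcδ₁ hδ₁ hd₁ hcδ₂ hδ₂ hd₂ x T hT hTd hx s₁)) g Φ) =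
      ((MpPsi.toRep (localSchrodinger F N T v)).comp s₁) g
        ((lineTransportOp E v c N hcδ₁ hδ₁ hd₁ hcδ₂ hδ₂ hd₂ x T hT hTd hx).symm Φ) := by
  rw [LinearEquiv.symm_apply_eq, lineTransportOp_equivariant, LinearEquiv.apply_symm_apply]

end Metaplectic

end Literature.RepresentationTheory.MoeglinVignerasWaldspurger1987

/-! ## §1b Congruence of the `e′_a` transported section in its pair-model section -/

namespace Literature.NumberTheory.GelbartRogawski1991.UnitaryDualPair.LocalSplitting

open Literature.NumberTheory.Automorphic.Liu2021.Def411WeilCarriers (TW JW JW_eq isSymm_TW)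

variable (F E : Type) [Field F] [NumberField F] [Field E] [NumberField E] [Algebra F E]
  [Algebra.IsQuadraticExtension F E] (c : E ≃ₐ[F] E) (N : ℕ)
  {δ : E} (hcδ : c δ = -δ) (hδ : δ ≠ 0) {d : F} (hd : δ * δ = algebraMap F E d)
  (TV : Matrix (Fin N) (Fin N) F) (hV : TV.IsSymm) (JV : Matrix (Fin N) (Fin N) E) (hJV : JV = TV.map (algebraMap F E))
  (a : Fˣ) (v : HeightOneSpectrum (𝓞 F))

/-- **two EQUAL pair-model sections have the same transported section** `lineTransportSection … a v s′ _` (the section proofs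
`hs′` are irrelevant) — the converse of `lineTransportSection_injective`; used to replace member `j`'s `χ`-splitting section by
any section with the same value at `v` (locality of the Kudla section in `μ_v`). [cite: MoeglinVignerasWaldspurger1987, Chap. 2 II.1; Chap. 3 I.1] -/
theorem lineTransportSection_congr
    {s₁' s₂' : localPi E c N (Matrix.reindex (Equiv.prodUnique (Fin N) (Fin 1)) (Equiv.prodUnique (Fin N) (Fin 1)) (JV ⊗ₖ JW F E a)) v →*
      LocalMp F N (gram F (Equiv.prodUnique (Fin N) (Fin 1)) TV (TW F a)) v}
    (hs₁' : ∀ g, MpPsi.proj _ (s₁' g) = iota F E c N hcδ hδ hd (gram F (Equiv.prodUnique (Fin N) (Fin 1)) TV (TW F a))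
      (isSymm_gram F (Equiv.prodUnique (Fin N) (Fin 1)) hV (isSymm_TW F a))
      (reindex_kronecker_eq_gram_map F E (Equiv.prodUnique (Fin N) (Fin 1)) hJV (JW_eq F E a)) v g)
    (hs₂' : ∀ g, MpPsi.proj _ (s₂' g) = iota F E c N hcδ hδ hd (gram F (Equiv.prodUnique (Fin N) (Fin 1)) TV (TW F a))
      (isSymm_gram F (Equiv.prodUnique (Fin N) (Fin 1)) hV (isSymm_TW F a))
      (reindex_kronecker_eq_gram_map F E (Equiv.prodUnique (Fin N) (Fin 1)) hJV (JW_eq F E a)) v g)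
    (h : s₁' = s₂') :
    lineTransportSection F E c N hcδ hδ hd TV hV JV hJV a v s₁' hs₁' = lineTransportSection F E c N hcδ hδ hd TV hV JV hJV a v s₂' hs₂' := by
  subst h
  rfl

end Literature.NumberTheory.GelbartRogawski1991.UnitaryDualPair.LocalSplitting

namespace Literature.NumberTheory.Automorphic.Liu2021.Def411WeilCarriers

open Literature.RepresentationTheory.MoeglinVignerasWaldspurger1987

variable (F E : Type) [Field F] [NumberField F] [Field E] [NumberField E] [Algebra F E]
variable (c : E ≃ₐ[F] E) (N : ℕ) (JV : Matrix (Fin N) (Fin N) E) {TV : Matrix (Fin N) (Fin N) F}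
variable [Algebra.IsQuadraticExtension F E] {δ : E} (hcδ : c δ = -δ) (hδ : δ ≠ 0) {d : F} (hd : δ * δ = algebraMap F E d)

/-! ## §2 The `ε`-summand of `LemD1_3AsPrintedI` supplies the class witness `x` at the transported lines `a_t⁻¹ δ` -/

/-- **The `ε`-summand yields the witness of the isometry transport**: for members `i, j` of the indexed family at `v` (any reindexing
`e`, representatives `eps t = (a_t δ) ⊗ 1`), `LemD1.SameClass (eps i) (eps j)` gives a unit `x` of `E_v` with
`a_j⁻¹δ ⊗ 1 = x · xᶜ · (a_i⁻¹δ ⊗ 1)` — the hypothesis `hx` of `lineTransportSplitting` at the lines `δ'_i = a_i⁻¹δ`, `δ'_j = a_j⁻¹δ` of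
the `e′_a` model transport (the two pairs of representatives differ by the norms `a_t · a_tᶜ = a_t²`,
`sameClass_epsLine_iff_sameClass_eps_lineDelta`). [cite: Liu2021, App. D §D.1 Step 1 (l. 5217), Lemma D.1 (3) (l. 5233)]
[cite: MoeglinVignerasWaldspurger1987, Chap. 3 I.1–I.3] -/
theorem exists_lineDelta_witness_of_sameClass_eps {n : ℕ} (e : Fin N × Fin 1 ≃ Fin n)
    (hV : TV.IsSymm) (hVd : IsUnit TV.det) (hJV : JV = TV.map (algebraMap F E))
    (hn : 3 ≤ n) {ι : Type} (aOf : ι → Fˣ) (χOf : ι → Chi F E c)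
    (𝓢Of : ∀ i, LocalSplitting.FinLocalSplittings F E c n hcδ hδ hd (gram F e TV (TW F (aOf i))) (isSymm_gram F e hV (isSymm_TW F (aOf i)))
      (reindex_kronecker_eq_gram_map F E e hJV (JW_eq F E (aOf i))))
    (μOf : ι → ∀ v : HeightOneSpectrum (𝓞 F), (LocalRing E v)ˣ →* ℂˣ) (hμn : ∀ i v x, ‖((μOf i v x : ℂˣ) : ℂ)‖ = 1)
    (hμc : ∀ i v, Continuous fun x => ((μOf i v x : ℂˣ) : ℂ))
    (hμF : ∀ (i : ι) (v : HeightOneSpectrum (𝓞 F)) (t : (v.adicCompletion F)ˣ),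
      μOf i v (Units.map (algebraMap (v.adicCompletion F) (LocalRing E v)).toMonoidHom t) = 1 ↔
        ∃ x : (LocalRing E v)ˣ, (x : LocalRing E v) * conjLocal E c v x = algebraMap (v.adicCompletion F) (LocalRing E v) t)
    (v : HeightOneSpectrum (𝓞 F)) (i j : ι)
    (h : LemD1.SameClass ((localIndexedFamilyAtV F E c N e JV hcδ hδ hd hV hVd hJV hn aOf χOf 𝓢Of μOf hμn hμc hμF v).eps i)
      ((localIndexedFamilyAtV F E c N e JV hcδ hδ hd hV hVd hJV hn aOf χOf 𝓢Of μOf hμn hμc hμF v).eps j)) :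
    ∃ x : (LocalRing E v)ˣ, algebraMap E (LocalRing E v) (algebraMap F E (↑(aOf j)⁻¹ : F) * δ) =
      (x : LocalRing E v) * conjLocal E c v x * algebraMap E (LocalRing E v) (algebraMap F E (↑(aOf i)⁻¹ : F) * δ) := by
  obtain ⟨x, hx⟩ := (sameClass_epsLine_iff_sameClass_eps_lineDelta F E c v (aOf i) (aOf j) (hδ := hδ)).1
    ((sameClass_eps_localIndexedFamilyAtV_iff F E c N e JV hcδ hδ hd hV hVd hJV hn aOf χOf 𝓢Of μOf hμn hμc hμF v i j).1 h)
  refine ⟨x, ?_⟩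
  rw [Units.ext_iff, Units.val_mul, Units.val_mul, Units.coe_map] at hx
  exact hx

/-! ## §3 «⇐» on the indexed family at `Equiv.prodUnique`: line-transported sections and equal `χ` give isomorphic `ω(μ, ε, χ)` -/

/-- **[Liu2021, App. D Lem. D.1 (3)], «⇐» direction, PLUMBING on the indexed family at the reindexing `Equiv.prodUnique (Fin N) (Fin 1)`**
(any rank `N ≥ 3`, ANY finite place `v` — split or not —, ANY splitting families `𝓢_t` of the pair models `a_t • T_V`, ANY Step-2
characters `μ_{t,•}`).  For members `i, j`, let `s_t := lineTransportSection … (a_t) v ((𝓢_t).s v) ((𝓢_t).proj_s v)` be their sections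
transported to the COMMON δ-model `LocalMp F N T_V v` (over `ι_{a_t⁻¹δ}`; `ω_{s_t} = (𝓢_t).omegaLoc v ∘ (k ↦ k ⊗ 1)` ON THE NOSE,
`omega_lineTransportSection_finLocalSplittings`).  IF for a unit `x` with `a_j⁻¹δ ⊗ 1 = x xᶜ (a_i⁻¹δ ⊗ 1)` the transported splitting
`q_x s_i q_x⁻¹ = lineTransportSplitting … x … (s_i)` EQUALS `s_j` (`hsec`), and the Step-3 characters agree (`hχ : chi j = chi i`), THEN
«`ω(μ_j, ε_j, χ_j) ≅ ω(μ_i, ε_i, χ_i)`» (`AreIsomorphicRep (quot j) (quot i)`, READING L7).  Proof: `M_x⁻¹` is `U(V)(F_v)`-equivariant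
from member `j`'s carrier to member `i`'s (§1, read through `uEquiv` and the two `omega_lineTransportSection_finLocalSplittings`
identities), then `LemD1IndexedFamily.areIsomorphicRep_quot_of_equivariant`. [cite: Liu2021, App. D Lemma D.1 (3) (l. 5233)]
[cite: MoeglinVignerasWaldspurger1987, Chap. 2 II.1 (A)–(B), Chap. 3 I.1–I.3, IV.4] [cite: HarrisKudlaSweet1996, §1] -/
theorem areIsomorphicRep_quot_of_lineTransportSplitting_eq_prodUnique
    (hV : TV.IsSymm) (hVd : IsUnit TV.det) (hJV : JV = TV.map (algebraMap F E)) (hn : 3 ≤ N)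
    {ι : Type} (aOf : ι → Fˣ) (χOf : ι → Chi F E c)
    (𝓢Of : ∀ i, LocalSplitting.FinLocalSplittings F E c N hcδ hδ hd (gram F (Equiv.prodUnique (Fin N) (Fin 1)) TV (TW F (aOf i)))
      (isSymm_gram F (Equiv.prodUnique (Fin N) (Fin 1)) hV (isSymm_TW F (aOf i)))
      (reindex_kronecker_eq_gram_map F E (Equiv.prodUnique (Fin N) (Fin 1)) hJV (JW_eq F E (aOf i))))
    (μOf : ι → ∀ v : HeightOneSpectrum (𝓞 F), (LocalRing E v)ˣ →* ℂˣ) (hμn : ∀ i v x, ‖((μOf i v x : ℂˣ) : ℂ)‖ = 1)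
    (hμc : ∀ i v, Continuous fun x => ((μOf i v x : ℂˣ) : ℂ))
    (hμF : ∀ (i : ι) (v : HeightOneSpectrum (𝓞 F)) (t : (v.adicCompletion F)ˣ),
      μOf i v (Units.map (algebraMap (v.adicCompletion F) (LocalRing E v)).toMonoidHom t) = 1 ↔
        ∃ x : (LocalRing E v)ˣ, (x : LocalRing E v) * conjLocal E c v x = algebraMap (v.adicCompletion F) (LocalRing E v) t)
    (v : HeightOneSpectrum (𝓞 F)) (i j : ι) (x : (LocalRing E v)ˣ)
    (hx : algebraMap E (LocalRing E v) (algebraMap F E (↑(aOf j)⁻¹ : F) * δ) =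
      (x : LocalRing E v) * conjLocal E c v x * algebraMap E (LocalRing E v) (algebraMap F E (↑(aOf i)⁻¹ : F) * δ))
    (hsec : lineTransportSplitting E v c N (conj_lineDelta hcδ (aOf i)) (lineDelta_ne_zero hδ (aOf i)) (lineDelta_mul_self hd (aOf i))
        (conj_lineDelta hcδ (aOf j)) (lineDelta_ne_zero hδ (aOf j)) (lineDelta_mul_self hd (aOf j)) x TV hV hVd hx
        (lineTransportSection F E c N hcδ hδ hd TV hV JV hJV (aOf i) v ((𝓢Of i).s v) ((𝓢Of i).proj_s v)) =
      lineTransportSection F E c N hcδ hδ hd TV hV JV hJV (aOf j) v ((𝓢Of j).s v) ((𝓢Of j).proj_s v))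
    (hχ : (localIndexedFamilyAtV F E c N (Equiv.prodUnique (Fin N) (Fin 1)) JV hcδ hδ hd hV hVd hJV hn aOf χOf 𝓢Of μOf hμn hμc hμF v).chi j =
      (localIndexedFamilyAtV F E c N (Equiv.prodUnique (Fin N) (Fin 1)) JV hcδ hδ hd hV hVd hJV hn aOf χOf 𝓢Of μOf hμn hμc hμF v).chi i) :
    AreIsomorphicRep
      ((localIndexedFamilyAtV F E c N (Equiv.prodUnique (Fin N) (Fin 1)) JV hcδ hδ hd hV hVd hJV hn aOf χOf 𝓢Of μOf hμn hμc hμF v).quot j)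
      ((localIndexedFamilyAtV F E c N (Equiv.prodUnique (Fin N) (Fin 1)) JV hcδ hδ hd hV hVd hJV hn aOf χOf 𝓢Of μOf hμn hμc hμF v).quot i) := by
  refine LemD1IndexedFamily.areIsomorphicRep_quot_of_equivariant _
    (lineTransportOp E v c N (conj_lineDelta hcδ (aOf i)) (lineDelta_ne_zero hδ (aOf i)) (lineDelta_mul_self hd (aOf i))
      (conj_lineDelta hcδ (aOf j)) (lineDelta_ne_zero hδ (aOf j)) (lineDelta_mul_self hd (aOf j)) x TV hV hVd hx).symm
    (fun g Φ => ?_) hχ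
  -- `ω_{s_t}(g') Ψ = ((𝓢_t).omegaLoc v ∘ (k ↦ k ⊗ 1))(g') Ψ` for `t = i, j` (the model transport, ON THE NOSE)
  have ei := fun (g' : localPi E c N JV v) (Ψ : SchwartzBruhat (Fin N → v.adicCompletion F)) => LinearMap.congr_fun
    (DFunLike.congr_fun (omega_lineTransportSection_finLocalSplittings F E c N hcδ hδ hd TV hV JV hJV (aOf i) v (𝓢Of i)) g') Ψ
  have ej := fun (g' : localPi E c N JV v) (Ψ : SchwartzBruhat (Fin N → v.adicCompletion F)) => LinearMap.congr_fun
    (DFunLike.congr_fun (omega_lineTransportSection_finLocalSplittings F E c N hcδ hδ hd TV hV JV hJV (aOf j) v (𝓢Of j)) g') Ψ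
  -- `M_x⁻¹ ω_{q_x s_i q_x⁻¹}(g') Φ = ω_{s_i}(g') (M_x⁻¹ Φ)` at `g' = uEquiv g`, with `q_x s_i q_x⁻¹ = s_j`
  have key := lineTransportOp_symm_equivariant E v c N (conj_lineDelta hcδ (aOf i)) (lineDelta_ne_zero hδ (aOf i))
    (lineDelta_mul_self hd (aOf i)) (conj_lineDelta hcδ (aOf j)) (lineDelta_ne_zero hδ (aOf j)) (lineDelta_mul_self hd (aOf j)) x TV hV
    hVd hx (lineTransportSection F E c N hcδ hδ hd TV hV JV hJV (aOf i) v ((𝓢Of i).s v) ((𝓢Of i).proj_s v))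
    (LemD1OfPlace.uEquiv E v c N JV hcδ hδ (by omega) (transpose_map_conj_JV F E c N JV hV hJV) (det_JV_ne_zero F E N JV hVd hJV) g) Φ
  rw [hsec, ej, ei] at key
  exact key

end Literature.NumberTheory.Automorphic.Liu2021.Def411WeilCarriers

end
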